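import Summits.Parity.GeneralizedHardyLittlewood.Theorems.PrimeLevelFamEdgeMomentsBeyondDiagonalDiagDecorMonomial
import HarnessLib

/-!
# Route `PrimeLevelFamEdge`, crux K_A `MomentsBeyondDiagonal` (stmt-Parity-20007), line «petersson_layers» v4, stub `stub_diag`:
# **the CRUDE bound for a product monomial of the decorated Selberg form:
# `|Σ_{c≤⌊M⌋}Σ_{g≤⌊M⌋/c} μ(g)c·Σ_{k₁,k₂} y′(cgk₁)y′(cgk₂)t₁(k₁)t₂(k₂)| ≤ C·A₁(M)A₂(M)·log M` whenever `|𝒮_i(n)| ≤ K_i·D(n)·A_i(M)`**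

Census R3(ii), ANALYTIC HALF — the third evaluation mode of a monomial, next to the master step (`…DiagDecorMonomial`,
`…DiagDecorBilinearTwoScale`: main term) and the `(log g)^r` bound (`…DiagDecorLogGMonomial`). Some monomials of the
per-order weights have a VANISHING main term at their formal degree (e.g. `(log k)^σ·τ_{1,1}(k)`, `σ ≥ 1`, whose profile
coordinate is `E_n·log^σM·(u_n − u_n)^σP(u_n) + O(D(1+κ)log^{σ−1}M) = O(D(n)(1+κ(n))log^{σ−1}M)`, cf.
`…DiagDecorLogShiftEngines`); for them only a crude size `|𝒮_i(n)| ≤ K_i·D(n)·A_i(M)` is available and suffices: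

* `abs_selbergMonomial_crude_le` — with `φ(n)W(n)² ≤ 1/n`, `(c,g) ↦ n` (`selbergCollapse_zero`) and `Σ_{n≤N}D(n)²/n ≤ A(2+log N)`:
  **`|monomial| ≤ (K₁K₂·3A)·A₁(M)A₂(M)·log M`** for `M ≥ 3` (`A = (Σ_d d^{−5/4})²`);
* `abs_selbergMonomial_crude_kappa_le` — the same with one factor allowed the size `K·D(n)(1+κ(n))·A(M)` (`Σ κD²/n ≪ log`).

Def-free; theorems only. Helper `--supports stmt-Parity-20007`; closes nothing; K_A, K_B and the Parity summit are NOT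
proved; nothing about Landau–Siegel zeros.

## References
* E. Kowalski, P. Michel, J. VanderKam, J. reine angew. Math. 526 (2000), (23)–(28) pp. 13–15.
  [cite: KowalskiMichelVanderKam2000, (23)–(28) — derivation (crude bounds for degenerate monomials of the diagonal term)]
-/

noncomputable section

open scoped Real ArithmeticFunction.Moebius
open Finset ArithmeticFunction Polynomial

namespace Summit.Parity.GeneralizedHardyLittlewood.Theorems.MomentsBeyondDiagonal.DiagKernel

open Literature.NumberTheory.LFunctions Literature.NumberTheory.LFunctions.KMV2000
open MollifierMainTerm (W)
open SelbergCoord (kappa)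
open Literature.NumberTheory.Sieve (one_le_log_of_three_le)
open Summit.Parity.GeneralizedHardyLittlewood.Theorems.BeyondDiagonalBeatsQuarter.KernelFormXSq
  (divWeight divWeight_nonneg totient_mul_W_sq_le sum_divWeight_sq_div_le sum_kappa_divWeight_sq_div_le)

/-- **Crude bound for a product monomial, one `κ`-factor allowed**: if `|𝒮₁(n)| ≤ K₁·D(n)(1+κ(n))·A₁(M)` and
`|𝒮₂(n)| ≤ K₂·D(n)·A₂(M)` for `M ≥ 3`, `1 ≤ n ≤ M` (`A_i ≥ 0`), then
`|Σ_{c≤⌊M⌋}Σ_{g≤⌊M⌋/c} μ(g)c·Σ_{k₁,k₂≤⌊M⌋/(cg)} y′(cgk₁)y′(cgk₂)t₁(k₁)t₂(k₂)| ≤ (K₁K₂·147A)·A₁(M)A₂(M)·log M`.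
[cite: KowalskiMichelVanderKam2000, (23)–(28) — derivation] -/
theorem abs_selbergMonomial_crude_kappa_le (P : ℝ[X]) (t₁ t₂ : ℕ → ℝ) (A₁ A₂ : ℝ → ℝ) {K₁ K₂ : ℝ}
    (hK₁ : 0 ≤ K₁) (hK₂ : 0 ≤ K₂) (hA₁ : ∀ M, 0 ≤ A₁ M) (hA₂ : ∀ M, 0 ≤ A₂ M)
    (h₁ : ∀ M : ℝ, 3 ≤ M → ∀ n : ℕ, n ≠ 0 → (n : ℝ) ≤ M →
      |∑ c ∈ Finset.range (P.natDegree + 1), P.coeff c *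
          ((∑ k ∈ Icc 1 ⌊M / n⌋₊, (if k.Coprime n then W k else 0) * t₁ k * Real.log (M / n / k) ^ c) /
            Real.log M ^ c)| ≤ K₁ * divWeight n * (1 + kappa n) * A₁ M)
    (h₂ : ∀ M : ℝ, 3 ≤ M → ∀ n : ℕ, n ≠ 0 → (n : ℝ) ≤ M →
      |∑ c ∈ Finset.range (P.natDegree + 1), P.coeff c *
          ((∑ k ∈ Icc 1 ⌊M / n⌋₊, (if k.Coprime n then W k else 0) * t₂ k * Real.log (M / n / k) ^ c) /
            Real.log M ^ c)| ≤ K₂ * divWeight n * A₂ M) :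
    ∀ M : ℝ, 3 ≤ M →
      |∑ c ∈ Icc 1 ⌊M⌋₊, ∑ g ∈ Icc 1 (⌊M⌋₊ / c), (μ g : ℝ) * c *
          ∑ k₁ ∈ Icc 1 (⌊M⌋₊ / (c * g)), ∑ k₂ ∈ Icc 1 (⌊M⌋₊ / (c * g)),
            ((μ (c * g * k₁) : ℝ) * ((psi (c * g * k₁))⁻¹ *
                P.eval (Real.log (M / ((c * g * k₁ : ℕ) : ℝ)) / Real.log M))) / ((c * g * k₁ : ℕ) : ℝ) *
              (((μ (c * g * k₂) : ℝ) * ((psi (c * g * k₂))⁻¹ *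
                P.eval (Real.log (M / ((c * g * k₂ : ℕ) : ℝ)) / Real.log M))) / ((c * g * k₂ : ℕ) : ℝ)) *
              (t₁ k₁ * t₂ k₂)| ≤
        K₁ * K₂ * (147 * (∑' d : ℕ, (d : ℝ) ^ (-(5 / 4 : ℝ))) ^ 2) * A₁ M * A₂ M * Real.log M := by
  intro M hM
  set S₁ : ℝ → ℕ → ℝ := fun M n ↦ ∑ c ∈ Finset.range (P.natDegree + 1), P.coeff c *
    ((∑ k ∈ Icc 1 ⌊M / n⌋₊, (if k.Coprime n then W k else 0) * t₁ k * Real.log (M / n / k) ^ c) /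
      Real.log M ^ c) with hS₁
  set S₂ : ℝ → ℕ → ℝ := fun M n ↦ ∑ c ∈ Finset.range (P.natDegree + 1), P.coeff c *
    ((∑ k ∈ Icc 1 ⌊M / n⌋₊, (if k.Coprime n then W k else 0) * t₂ k * Real.log (M / n / k) ^ c) /
      Real.log M ^ c) with hS₂
  set A : ℝ := (∑' d : ℕ, (d : ℝ) ^ (-(5 / 4 : ℝ))) ^ 2 with hA
  have hA0 : 0 ≤ A := by positivity
  set ℓ := Real.log M with hℓ
  have hℓ1 : 1 ≤ ℓ := one_le_log_of_three_le hM
  have hM0 : 0 < M := by linarith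
  set N := ⌊M⌋₊ with hN
  have hN1 : 1 ≤ N := Nat.le_floor (by norm_num; linarith)
  have hlogN : Real.log N ≤ ℓ := Real.log_le_log (by exact_mod_cast hN1) (Nat.floor_le hM0.le)
  -- factor and collapse
  have hinner : ∀ c ∈ Icc 1 N, ∀ g ∈ Icc 1 (N / c),
      (μ g : ℝ) * c * ∑ k₁ ∈ Icc 1 (N / (c * g)), ∑ k₂ ∈ Icc 1 (N / (c * g)),
        ((μ (c * g * k₁) : ℝ) * ((psi (c * g * k₁))⁻¹ *
            P.eval (Real.log (M / ((c * g * k₁ : ℕ) : ℝ)) / Real.log M))) / ((c * g * k₁ : ℕ) : ℝ) *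
          (((μ (c * g * k₂) : ℝ) * ((psi (c * g * k₂))⁻¹ *
            P.eval (Real.log (M / ((c * g * k₂ : ℕ) : ℝ)) / Real.log M))) / ((c * g * k₂ : ℕ) : ℝ)) *
          (t₁ k₁ * t₂ k₂) =
      (μ g : ℝ) * c * (W (c * g) ^ 2 * (S₁ M (c * g) * S₂ M (c * g))) := by
    intro c hc g hg
    have hc0 : c ≠ 0 := by have := (Finset.mem_Icc.1 hc).1; omega
    have hg0 : g ≠ 0 := by have := (Finset.mem_Icc.1 hg).1; omega
    rw [hN, selbergInner_eq_W_sq_mul P M (mul_ne_zero hc0 hg0) t₁ t₂]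
  rw [Finset.sum_congr rfl fun c hc ↦ Finset.sum_congr rfl fun g hg ↦ hinner c hc g hg,
    selbergCollapse_zero N (fun n ↦ W n ^ 2 * (S₁ M n * S₂ M n))]
  -- termwise
  have hterm : ∀ n ∈ Icc 1 N, |(Nat.totient n : ℝ) * (W n ^ 2 * (S₁ M n * S₂ M n))| ≤
      K₁ * K₂ * A₁ M * A₂ M * ((1 + kappa n) * divWeight n ^ 2 / n) := by
    intro n hn
    have hn' := Finset.mem_Icc.1 hn
    have hn0 : n ≠ 0 := by omega
    have hnM : (n : ℝ) ≤ M := le_trans (by exact_mod_cast hn'.2) (Nat.floor_le hM0.le)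
    have hD := divWeight_nonneg n
    have hκ : 0 ≤ kappa n := by
      unfold kappa
      exact Finset.sum_nonneg fun p hp ↦ by
        have hp2 : (2 : ℝ) ≤ p := by exact_mod_cast (Nat.prime_of_mem_primeFactors hp).two_le
        exact div_nonneg (Real.log_nonneg (by linarith)) (by linarith)
    have hφW := totient_mul_W_sq_le n
    have hφW0 : 0 ≤ (Nat.totient n : ℝ) * W n ^ 2 := by positivity
    have hb₁ : |S₁ M n| ≤ K₁ * divWeight n * (1 + kappa n) * A₁ M := by
      simpa only [hS₁] using h₁ M hM n hn0 hnM
    have hb₂ : |S₂ M n| ≤ K₂ * divWeight n * A₂ M := by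
      simpa only [hS₂] using h₂ M hM n hn0 hnM
    have hn0' : (0 : ℝ) < n := by exact_mod_cast Nat.pos_of_ne_zero hn0
    have hA₁M := hA₁ M
    have hA₂M := hA₂ M
    have hK₁' : 0 ≤ K₁ * divWeight n * (1 + kappa n) * A₁ M := by positivity
    rw [show (Nat.totient n : ℝ) * (W n ^ 2 * (S₁ M n * S₂ M n)) =
      ((Nat.totient n : ℝ) * W n ^ 2) * (S₁ M n * S₂ M n) by ring, abs_mul, abs_of_nonneg hφW0, abs_mul]
    calc (Nat.totient n : ℝ) * W n ^ 2 * (|S₁ M n| * |S₂ M n|)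
        ≤ (n : ℝ)⁻¹ * ((K₁ * divWeight n * (1 + kappa n) * A₁ M) * (K₂ * divWeight n * A₂ M)) :=
          mul_le_mul hφW (mul_le_mul hb₁ hb₂ (abs_nonneg _) hK₁') (by positivity) (by positivity)
      _ = K₁ * K₂ * A₁ M * A₂ M * ((1 + kappa n) * divWeight n ^ 2 / n) := by
          field_simp
  -- sum
  have hsum : ∑ n ∈ Icc 1 N, (1 + kappa n) * divWeight n ^ 2 / n ≤ 49 * A * (3 * ℓ) := by
    have h1 := sum_divWeight_sq_div_le hN1
    have h2 := sum_kappa_divWeight_sq_div_le hN1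
    rw [← hA] at h1 h2
    have hsplit : ∑ n ∈ Icc 1 N, (1 + kappa n) * divWeight n ^ 2 / n =
        ∑ n ∈ Icc 1 N, divWeight n ^ 2 / n + ∑ n ∈ Icc 1 N, kappa n * divWeight n ^ 2 / n := by
      rw [← Finset.sum_add_distrib]; exact Finset.sum_congr rfl fun n _ ↦ by ring
    rw [hsplit]
    calc _ ≤ A * (2 + Real.log N) + 48 * A * (2 + Real.log N) := add_le_add h1 h2
      _ = 49 * A * (2 + Real.log N) := by ring
      _ ≤ 49 * A * (3 * ℓ) := mul_le_mul_of_nonneg_left (by linarith) (by positivity)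
  calc |∑ n ∈ Icc 1 N, (Nat.totient n : ℝ) * (W n ^ 2 * (S₁ M n * S₂ M n))|
      ≤ ∑ n ∈ Icc 1 N, |(Nat.totient n : ℝ) * (W n ^ 2 * (S₁ M n * S₂ M n))| := Finset.abs_sum_le_sum_abs _ _
    _ ≤ ∑ n ∈ Icc 1 N, K₁ * K₂ * A₁ M * A₂ M * ((1 + kappa n) * divWeight n ^ 2 / n) := Finset.sum_le_sum hterm
    _ = K₁ * K₂ * A₁ M * A₂ M * ∑ n ∈ Icc 1 N, (1 + kappa n) * divWeight n ^ 2 / n := by rw [Finset.mul_sum]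
    _ ≤ K₁ * K₂ * A₁ M * A₂ M * (49 * A * (3 * ℓ)) :=
        mul_le_mul_of_nonneg_left hsum (by have := hA₁ M; have := hA₂ M; positivity)
    _ = K₁ * K₂ * (147 * A) * A₁ M * A₂ M * ℓ := by ring

/-- **Crude bound for a product monomial** (both factors `|𝒮_i(n)| ≤ K_i·D(n)·A_i(M)`): the bound of
`abs_selbergMonomial_crude_kappa_le` (`1 ≤ 1 + κ(n)`). [cite: KowalskiMichelVanderKam2000, (23)–(28) — derivation] -/
theorem abs_selbergMonomial_crude_le (P : ℝ[X]) (t₁ t₂ : ℕ → ℝ) (A₁ A₂ : ℝ → ℝ) {K₁ K₂ : ℝ}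
    (hK₁ : 0 ≤ K₁) (hK₂ : 0 ≤ K₂) (hA₁ : ∀ M, 0 ≤ A₁ M) (hA₂ : ∀ M, 0 ≤ A₂ M)
    (h₁ : ∀ M : ℝ, 3 ≤ M → ∀ n : ℕ, n ≠ 0 → (n : ℝ) ≤ M →
      |∑ c ∈ Finset.range (P.natDegree + 1), P.coeff c *
          ((∑ k ∈ Icc 1 ⌊M / n⌋₊, (if k.Coprime n then W k else 0) * t₁ k * Real.log (M / n / k) ^ c) /
            Real.log M ^ c)| ≤ K₁ * divWeight n * A₁ M)
    (h₂ : ∀ M : ℝ, 3 ≤ M → ∀ n : ℕ, n ≠ 0 → (n : ℝ) ≤ M →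
      |∑ c ∈ Finset.range (P.natDegree + 1), P.coeff c *
          ((∑ k ∈ Icc 1 ⌊M / n⌋₊, (if k.Coprime n then W k else 0) * t₂ k * Real.log (M / n / k) ^ c) /
            Real.log M ^ c)| ≤ K₂ * divWeight n * A₂ M) :
    ∀ M : ℝ, 3 ≤ M →
      |∑ c ∈ Icc 1 ⌊M⌋₊, ∑ g ∈ Icc 1 (⌊M⌋₊ / c), (μ g : ℝ) * c *
          ∑ k₁ ∈ Icc 1 (⌊M⌋₊ / (c * g)), ∑ k₂ ∈ Icc 1 (⌊M⌋₊ / (c * g)),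
            ((μ (c * g * k₁) : ℝ) * ((psi (c * g * k₁))⁻¹ *
                P.eval (Real.log (M / ((c * g * k₁ : ℕ) : ℝ)) / Real.log M))) / ((c * g * k₁ : ℕ) : ℝ) *
              (((μ (c * g * k₂) : ℝ) * ((psi (c * g * k₂))⁻¹ *
                P.eval (Real.log (M / ((c * g * k₂ : ℕ) : ℝ)) / Real.log M))) / ((c * g * k₂ : ℕ) : ℝ)) *
              (t₁ k₁ * t₂ k₂)| ≤
        K₁ * K₂ * (147 * (∑' d : ℕ, (d : ℝ) ^ (-(5 / 4 : ℝ))) ^ 2) * A₁ M * A₂ M * Real.log M := by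
  refine abs_selbergMonomial_crude_kappa_le P t₁ t₂ A₁ A₂ hK₁ hK₂ hA₁ hA₂ (fun M hM n hn hnM ↦ ?_) h₂
  have hD := divWeight_nonneg n
  have hκ : 0 ≤ kappa n := by
    unfold kappa
    exact Finset.sum_nonneg fun p hp ↦ by
      have hp2 : (2 : ℝ) ≤ p := by exact_mod_cast (Nat.prime_of_mem_primeFactors hp).two_le
      exact div_nonneg (Real.log_nonneg (by linarith)) (by linarith)
  refine (h₁ M hM n hn hnM).trans ?_
  have : K₁ * divWeight n * A₁ M = K₁ * divWeight n * 1 * A₁ M := by ring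
  rw [this]
  have hA := hA₁ M
  gcongr
  linarith

end Summit.Parity.GeneralizedHardyLittlewood.Theorems.MomentsBeyondDiagonal.DiagKernel

end
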